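import Summits.QuantumFields.BalabanUV.T4Continuum.Support.G183FreePartPieces

/-!
# G183FreePartRate — the η-RATE OF THE FREE PART of Bałaban's (1.83) propagator at `U = 1`, PROVED:
# `G183KernelRates.FreePartRate d N` for every `d` and `N` (exponents `γ = 2`, `δ = 1/64`), by heat-kernel subordination
# of the lattice resolvent power and the tree's one-dimensional Chernoff / Gaussian local-limit bounds

Tree target `Summits/QuantumFields/BalabanUV/T4Continuum/Support/` (LEAN PLACEMENT RULE 2026-08-19: new cell work under
`Summits/`, published results only under `Literature/`).  Cell `pub-balaban`, T4-DAG §5 node U1a, spine estimate NE2 (η-rate of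
the one-step LINEAR operators), prover P2, lineage t4-ne2-p2 gen 8, row T4-U1a.E-NE2-PROVE-P2h*.  Part 5/5 = the theorem;
the proof is ONE argument split over five ≤ 400-line files of the same namespace, `G183FreePartOneDim` (§1–§2) →
`G183FreePartSubordination` (§3–§4) → `G183FreePartProducts` (§5–§6) → `G183FreePartPieces` (§7) → this file (§8), whose
external imports are BY NAME only: `G183KernelRates` (gen 7: the objects `freeKer`, `FreePartRateShape`, `FreePartRate` =
the typed wall) and `Literature.Probability.LatticeModels.{SRWHeatKernel1D, SRWHeatKernelLCLT, LatticeGreenHeatKernel,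
LatticeGreenAsymptotics}` (the formalised random-walk inputs after Lawler–Limic 2010).  Nothing in either is edited.

HONEST FRAMING (page 1).  Rung (B)+1 bookkeeping for the LINEAR theory at background `U = 1` on the infinite fine lattices
`(1/n)ℤ^{d+1}` (the `ℤ^{d+1}` idealisation of gen 7 §2–§3); NOT the torus, NOT `U ≠ 1` (NE2⁺), NOT infinite-volume physics,
NOT a mass gap, NOT Clay, NOT summit progress.  The cell conditionals BetaPertH, (B), (B^μ) do not occur.  Nothing printed
in the audited papers (B5; King 1986) is used as a hypothesis: the only inputs are Mathlib and kernel-proved tree theorems,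
by name.  No `def … : Prop` is assumed anywhere; no `sorry`; axioms of the main theorems = {propext, Classical.choice,
Quot.sound} (checked with `#print axioms`).

WHAT IS PROVED (kernel).  MAIN: `freePartRate (d N : ℕ) : G183KernelRates.FreePartRate d N` and the explicit-exponent form
`freePartRateShape_two (d N : ℕ) : ∃ C, G183KernelRates.FreePartRateShape d N 2 C (1/64)` — for all fine levels
`1 ≤ n ≤ m`, every `x ≠ 0` in `ℤ^{d+1}` and its copy `x′` at level `m` (`x′·n = x·m`):
    `‖freeKer m N x′ − freeKer n N x‖ ≤ C(d,N) · n^{−2} · ρ^{1−d−2} · e^{−ρ/64}`,   `ρ = |x|_∞ / n`,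
i.e. gen 7's MISSING INEQUALITY (§3 of `G183KernelRates`, there a [shape] only, «NOT proved») with `γ = 2`.  King's printed
single-scale rate (Prop. 3.9 (3.73) p. 665, for his covariant propagators, «γ sufficiently small») asks much less; `γ = 2`
is available here because at `U = 1` the free part is an exact function of the lattice Laplacian and the level-`l` heat
kernel approaches its Gaussian limit at the local-CLT rate `l^{−2}`.  `C(d,N)` is explicit (a polynomial in `2^N`, `(d+1)!`,
`Γ((d+1)/2)`, `64^{d+1}` and the local-CLT constant `C₂ = 512((16e⁵π⁶+2)+8e⁵π²)/(2π)`); no optimality is claimed for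
`(γ, δ, C) = (2, 1/64, C(d,N))` — `δ = 1/64` is what the crudest exponential bookkeeping leaves.  COROLLARY
(unconditional form of gen 7's `freePartRateShape_offDiag`): `freeKerFamily_succ_sub_le` — on the levels `n = L^k`, at every
coarse point `y ≠ 0` (`d ≥ 1`), `|K^free_{L^{k+1}}(L^{k+1}•y) − K^free_{L^k}(L^k•y)| ≤ C·(L^{−2})^k·e^{−|y|_∞/64}`, i.e.
King's scale-summable `L^{−γk}` with `γ = 2`; no bound of this kind exists at `y = 0` (gen 7 `freeKerFamily_zero_unbounded`).

THE PROOF (uniform in `d ≥ 0`; sup-norm throughout; NO polynomial weights — every estimate keeps one exponential).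
§3–§4 SUBORDINATION: `Σ_{j<N}(F+1)^{−(j+1)} = ∫₀^∞ w_N(t)e^{−tF}dt`, `w_N(t) = e^{−t}Σ_{j<N}t^j/j! ≤ 2^N e^{−t/2}`
  (`resolvSum_eq_integral`, `wN_le`), applied under the Brillouin-zone integral (Fubini; the tree's product formula
  `setIntegral_prod_srwHeatIntegrand`): `freeKer l N y = ∫₀^∞ w_N(t)·P_l(t,y)dt`, `P_l(t,y) = Π_ν l·q_{2l²t}(y_ν)`
  (`freeKer_eq_integral`; the level-`l` symbol is `l²Σ_μ(2−2cos p_μ)`, whence the time change `s = 2l²t`).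
§1–§2 ONE-DIMENSIONAL INPUTS with one exponential weight kept (from the tree's free-`λ` Chernoff bounds
  `abs_srwHeatKernel_le_exp` / `abs_srwHeatKernel_le_of_nonneg` and the local-CLT core `srwHeatKernel_sub_gauss_core`):
  (U0) `|q_s(k)| ≤ e^{7/8}e^{−|k|}` (`s ≤ 1`); (U1) `|q_s(k)| ≤ s^{−1/2}(e^{−k²/8s} + e^{−|k|/8})` (`s ≥ 1`);
  (U2) `|q_s(k) − φ_s(k)| ≤ C₂ s^{−3/2}(e^{−k²/16s} + e^{−|k|/16})` (`s ≥ 1`); in physical variables the level-`l` kernel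
  `l·q_{2l²t}(k)` is within `(C₂/l²)(2t)^{−3/2}(e^{−(k/l)²/32t} + e^{−|k|/16})` of the LEVEL-FREE Gaussian
  `Φ_t(k/l) = e^{−(k/l)²/4t}/√(4πt)` (`abs_levelKer_sub_Phi_le`) — the source of the rate `n^{−2}`.
§5–§6 PRODUCTS: telescoping (the tree's `abs_prod_sub_prod_le`) across the `d+1` coordinates against the common Gaussian
  majorant: `|P_m(t,x′) − P_n(t,x)| ≤ (d+1)·2C₂·2^d · n^{−2}(2t)^{−(d+3)/2}(e^{−ρ²/32t} + e^{−|x|_∞/16})` for `2n²t ≥ 1`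
  (`abs_levelProd_sub_le`); small times `|P_l(t,y)| ≤ (le^{7/8})^{d+1}e^{−|y|_∞}` (`abs_levelProd_le_small`, `2l²t ≤ 1`);
  `|P_l(t,y)| ≤ 2^d(2t)^{−(d+1)/2}(e^{−(y/l)²_∞/16t} + e^{−|y|_∞/8})` (`abs_levelProd_le_large`, `2l²t ≥ 1`).
§7–§8 FOUR TIME-PIECES, split at `b = 1/(2m²) ≤ a = 1/(2n²)`: (A–B) `t > a`, the telescoped difference against
  `2^N e^{−t/2}` — half of the mass turns `e^{−ρ²/32t}` into `e^{−ρ/8}e^{−ρ²/64t}` (`exp_half_mul_gauss_le`), then the Γ-integral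
  `∫₀^∞ t^{−(d+3)/2}e^{−ρ²/64t}dt = 8^{d+1}Γ((d+1)/2)ρ^{−(d+1)}` (`gaussTimeIntegral`, from the tree's
  `integral_Ioi_rpow_neg_mul_exp_neg_div`) and `∫_a^∞ t^{−(d+3)/2}dt = (2/(d+1))a^{−(d+1)/2} ≤ (2/(d+1))(2n)^{d+1}` with
  `n^{d+1}e^{−|x|_∞/16} ≤ 32^{d+1}(d+1)!·ρ^{−(d+1)}e^{−ρn/32}` (`piece_large`); (C) `t ≤ 1/(2l²)` at each level separately,
  `l^{d+1}e^{−ρl} ≤ 2^{d+1}(d+1)!·ρ^{−(d+1)}e^{−ρl/2}` (`piece_small`); (E) `b < t ≤ a`, level `m` alone: Gaussian part by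
  `(2t)^{−D/2}e^{−ρ²/32t} ≤ 16^D D! e^{1/16}ρ^{−D}` (`gaussFactor_le`, `D = d+1`) and `e^{−ρ²/32t} ≤ e^{−ρ/16}` (as
  `2t ≤ 1/n² ≤ ρ`), Poisson part by `(2t)^{−D/2} ≤ m^D` (`piece_mid`).  Every lattice power of a level is paid for by half
  an exponential in the LATTICE distance `ρ·l ≥ 1` (`pow_mul_exp_le_inv_pow`) — this is where `x ≠ 0` (`|x|_∞ ≥ 1`)
  enters, consistent with gen 7's theorem that NO bound of this kind survives at the coincident point
  (`G183KernelRates.not_ratePair_freeKerFamily`, `freeKerFamily_zero_unbounded`).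

READING / WHAT THIS CLOSES.  Gen 7 located the cell's last `U = 1` linear-theory gap of object X9 ((1.83)) in the
two-leg-fine FREE part and typed the missing inequality; this file proves it (unconditionally, all `d`, all `N`).  (Record
correction carried from XREAD C-t4l-75 of `G183KernelRates` v1, DOCFIX D1: there `FreePartRateShape` is not «a hypothesis of
no theorem» literally — it is the antecedent of the bookkeeping implication `G183KernelRates.freePartRateShape_offDiag`, never
discharged in that file; it is discharged HERE, so that implication now yields its conclusion unconditionally at `γ = 2`.)  So at
`U = 1` the free part of X9 — in King's scale-covariant pointwise currency on the infinite fine lattices (NOT `RatePair`,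
which gen 7 proved impossible for it) — joins the regular part (gen 7 `ratePair_kerGFamily`) and the lineage's X8 (1.66),
X10 (1.63), X11 (2.156) rates as a kernel theorem.  Its printed consumer is perturbative power counting (King p. 665 «Redoing
the analysis, we see that the degrees of some subgraphs have been reduced by γ»), i.e. the cell's BetaPertH sector.
NOT COVERED: the torus / finite-volume version (method: Poisson summation over the periods, same pieces — not done);
`U ≠ 1`; the one-leg-paired cube currency `T4EtaRate.EtaRateIneq342` (needs block averages of `freeKer`; successor item);
optimality of the constants.

SOURCES (locations and method sentences only; nothing printed is a hypothesis).  G. F. Lawler, V. Limic, *Random Walk: A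
Modern Introduction*, CUP 2010 [LawlerLimic2010], §2.3 (local CLT) and Thm. 4.3.1 with its heat-kernel proof — as FORMALISED
in the tree files named above; this file re-uses their theorems by name and repeats their subordination / telescoping pattern
with exponential instead of polynomial weights, for a DIFFERENCE OF TWO LEVELS.  T. Bałaban, *Propagators and renormalization
transformations for lattice gauge theories. I*, Commun. Math. Phys. **95** (1984) [Balaban1984PropagatorsI] = cell paper B5:
(1.83) p. 31, (1.110) p. 35 (the `η^{2−d}` coincidence singularity = the `ρ^{−(d+1)}`-bookkeeping here).  C. King, *The U(1)
Higgs model. I*, Commun. Math. Phys. **102** (1986) [King1986]: (2.17) p. 653, Prop. 3.9 (3.73)–(3.75) p. 665 (read as OCR text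
`lit read paper:king1986-cmp102-king-u1-higgs-i` p. 17).  What is reproduced: the standard heat-kernel proof of lattice
Green-function asymptotics, adapted; NOTHING of B5's or King's own arguments.
-/

noncomputable section

open MeasureTheory Set Filter Real
open scoped Real Topology BigOperators

namespace Summit.QuantumFields.BalabanUV.T4Continuum.G183FreePartRate

open Literature.Probability.LatticeModels

/-! ## §8 The rate -/

section Main

open Literature.MathematicalPhysics.QuantumFieldTheory.Balaban1983to89

/-- **THE FREE-PART RATE at `γ = 2`, `δ = 1/64`** (discharges the typed wall `G183KernelRates.FreePartRate`):
for every `d, N` there is `C = C(d,N)` with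
`‖K^free_m(x′) − K^free_n(x)‖ ≤ C · n^{−2} · ρ^{−(d+1)} · e^{−ρ/64}`, `ρ = ‖x‖_∞/n`, for all levels `n ≤ m`, fine points
`x ≠ 0` of level `n` and their copies `x′` (`x′·n = x·m`) at level `m`.  Printed inputs (by name, as formalised in the
tree): heat-kernel subordination of the lattice resolvent power (`LatticeGreenHeatKernel`, after Lawler–Limic 2010,
Thm. 4.3.1), the 1D Chernoff and local-CLT bounds of `SRWHeatKernel1D` / `SRWHeatKernelLCLT` (ibid. §2.3), elementary
Γ-integrals. [folklore] -/
theorem freePartRateShape_two (d N : ℕ) : ∃ C : ℝ, G183KernelRates.FreePartRateShape d N 2 C (1 / 64) := by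
  set KS : ℝ := 2 ^ N * Real.exp (7 / 8) ^ (d + 1) * (2 ^ (d + 1) * (d + 1).factorial) with hKS
  set KM : ℝ := 2 ^ N * 2 ^ d * (16 ^ (d + 1) * (d + 1).factorial * (Real.exp (1 / 16) + 1)) with hKM
  set KL : ℝ := 2 ^ N * (((d : ℝ) + 1) * (2 * C2) * 2 ^ d) *
      (8 ^ (d + 1) * Real.Gamma (((d : ℝ) + 1) / 2) + 2 / ((d : ℝ) + 1) * (64 ^ (d + 1) * (d + 1).factorial))
    with hKL
  refine ⟨KS + KM + KS + KL, ?_⟩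
  intro n m _ _ hnm x x' hx hx'
  have hn : 1 ≤ n := NeZero.one_le
  have hm : 1 ≤ m := hn.trans hnm
  have hn0 : (0 : ℝ) < n := by exact_mod_cast hn
  have hm0 : (0 : ℝ) < m := by exact_mod_cast hm
  have hn1 : (1 : ℝ) ≤ n := by exact_mod_cast hn
  have hnm' : (n : ℝ) ≤ m := by exact_mod_cast hnm
  have hd0 := Nat.cast_nonneg (α := ℝ) d
  -- the sup-norm coordinate `i₀`, `u = ‖x‖_∞ ≥ 1`, `ρ = u/n`
  obtain ⟨i₀, hi₀⟩ := B4ContourShift.exists_supNorm_eq x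
  set u : ℝ := B4ContourShift.supNorm x with hu
  have hxi : |((x i₀ : ℤ) : ℝ)| = u := by rw [hi₀, Int.cast_abs]
  have hu1 : 1 ≤ u := by
    obtain ⟨j, hj⟩ : ∃ j, x j ≠ 0 := by
      by_contra h
      push Not at h
      exact hx (funext h)
    have h1 : (1 : ℝ) ≤ ((|x j| : ℤ) : ℝ) := by exact_mod_cast Int.one_le_abs hj
    exact h1.trans (B4ContourShift.abs_le_supNorm x j)
  set ρ : ℝ := u / n with hρdef
  have hρ : 0 < ρ := by positivity
  have hun : u = ρ * n := by rw [hρdef]; field_simp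
  have hρn : 1 ≤ ρ * n := hun ▸ hu1
  -- the copy `x′`
  have hx'r : ((x' i₀ : ℤ) : ℝ) * n = ((x i₀ : ℤ) : ℝ) * m := by exact_mod_cast hx' i₀
  have habs' : |((x' i₀ : ℤ) : ℝ)| = ρ * m := by
    have h1 : |((x' i₀ : ℤ) : ℝ)| * n = u * m := by
      rw [← hxi, ← abs_of_pos hn0, ← abs_mul, hx'r, abs_mul, abs_of_pos hm0]
    rw [hun] at h1
    exact mul_right_cancel₀ hn0.ne' (h1.trans (by ring))
  have hsq' : (((x' i₀ : ℤ) : ℝ) / m) ^ 2 = ρ ^ 2 := by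
    rw [div_pow, ← sq_abs, habs']; field_simp
  have hy_n : ρ * n ≤ |((x i₀ : ℤ) : ℝ)| := by rw [hxi, hun]
  have hy_m : ρ * m ≤ |((x' i₀ : ℤ) : ℝ)| := habs'.symm.le
  -- the two subordination representations, split at `b = 1/(2m²) ≤ a = 1/(2n²)`
  obtain ⟨hIn, hEn⟩ := freeKer_eq_integral (d := d) n N x
  obtain ⟨hIm, hEm⟩ := freeKer_eq_integral (d := d) m N x'
  rw [hEm, hEn, ← Complex.ofReal_sub, Complex.norm_real]
  set a : ℝ := 1 / (2 * (n : ℝ) ^ 2) with ha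
  set b : ℝ := 1 / (2 * (m : ℝ) ^ 2) with hb
  have ha0 : 0 < a := by positivity
  have hb0 : 0 < b := by positivity
  have hba : b ≤ a := by
    rw [ha, hb]
    exact one_div_le_one_div_of_le (by positivity) (by nlinarith [mul_le_mul hnm' hnm' hn0.le hm0.le])
  have splitn : ∫ t in Ioi (0 : ℝ), wN N t * levelProd (d := d) n t x =
      (∫ t in Ioc (0 : ℝ) a, wN N t * levelProd (d := d) n t x) + ∫ t in Ioi a, wN N t * levelProd (d := d) n t x := by
    rw [← setIntegral_union Set.Ioc_disjoint_Ioi_same measurableSet_Ioi (hIn.mono_set Set.Ioc_subset_Ioi_self)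
      (hIn.mono_set (Set.Ioi_subset_Ioi ha0.le)), Set.Ioc_union_Ioi_eq_Ioi ha0.le]
  have splitm : ∫ t in Ioi (0 : ℝ), wN N t * levelProd (d := d) m t x' =
      ((∫ t in Ioc (0 : ℝ) b, wN N t * levelProd (d := d) m t x') +
        ∫ t in Ioc b a, wN N t * levelProd (d := d) m t x') + ∫ t in Ioi a, wN N t * levelProd (d := d) m t x' := by
    rw [← setIntegral_union (Set.Ioc_disjoint_Ioc_of_le le_rfl) measurableSet_Ioc
        (hIm.mono_set Set.Ioc_subset_Ioi_self) (hIm.mono_set fun t ht => hb0.trans ht.1),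
      Set.Ioc_union_Ioc_eq_Ioc hb0.le hba,
      ← setIntegral_union Set.Ioc_disjoint_Ioi_same measurableSet_Ioi (hIm.mono_set Set.Ioc_subset_Ioi_self)
        (hIm.mono_set (Set.Ioi_subset_Ioi ha0.le)), Set.Ioc_union_Ioi_eq_Ioi ha0.le]
  have hL : (∫ t in Ioi a, wN N t * levelProd (d := d) m t x') - ∫ t in Ioi a, wN N t * levelProd (d := d) n t x =
      ∫ t in Ioi a, wN N t * (levelProd (d := d) m t x' - levelProd (d := d) n t x) := by
    rw [← integral_sub (hIm.mono_set (Set.Ioi_subset_Ioi ha0.le)) (hIn.mono_set (Set.Ioi_subset_Ioi ha0.le))]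
    congr 1; funext t; ring
  rw [splitm, splitn]
  have e : ((∫ t in Ioc (0 : ℝ) b, wN N t * levelProd (d := d) m t x') +
        ∫ t in Ioc b a, wN N t * levelProd (d := d) m t x') + (∫ t in Ioi a, wN N t * levelProd (d := d) m t x') -
      ((∫ t in Ioc (0 : ℝ) a, wN N t * levelProd (d := d) n t x) + ∫ t in Ioi a, wN N t * levelProd (d := d) n t x) =
      ((∫ t in Ioc (0 : ℝ) b, wN N t * levelProd (d := d) m t x') +
        ∫ t in Ioc b a, wN N t * levelProd (d := d) m t x') +
      -(∫ t in Ioc (0 : ℝ) a, wN N t * levelProd (d := d) n t x) +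
      ∫ t in Ioi a, wN N t * (levelProd (d := d) m t x' - levelProd (d := d) n t x) := by
    rw [← hL]; ring
  rw [e]
  -- the four pieces
  have hSm := piece_small (d := d) N hn hnm x' i₀ hρ hy_m
  have hSn := piece_small (d := d) N hn le_rfl x i₀ hρ hy_n
  have hM := piece_mid (d := d) N hn hnm x' i₀ hρ hρn hsq' habs'
  have hLg := piece_large (d := d) N hn hnm x x' hx' i₀ hρ hu1 hun hxi
  have e2 : Real.exp (-(ρ / 2)) ≤ Real.exp (-(ρ / 64)) := Real.exp_le_exp.2 (by linarith [hρ.le])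
  have e16 : Real.exp (-(ρ / 16)) ≤ Real.exp (-(ρ / 64)) := Real.exp_le_exp.2 (by linarith [hρ.le])
  have hKS0 : 0 ≤ KS := by positivity
  have hKM0 : 0 ≤ KM := by positivity
  set X : ℝ := ((n : ℝ) ^ 2)⁻¹ * (ρ ^ (d + 1))⁻¹ with hX
  have hX0 : 0 ≤ X := by positivity
  set A : ℝ := ∫ t in Ioc (0 : ℝ) b, wN N t * levelProd (d := d) m t x' with hA
  set B : ℝ := ∫ t in Ioc b a, wN N t * levelProd (d := d) m t x' with hB
  set C : ℝ := ∫ t in Ioc (0 : ℝ) a, wN N t * levelProd (d := d) n t x with hC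
  set L : ℝ := ∫ t in Ioi a, wN N t * (levelProd (d := d) m t x' - levelProd (d := d) n t x) with hL'
  have hT : ‖A + B + -C + L‖ ≤ (KS + KM + KS + KL) * X * Real.exp (-(ρ / 64)) := by
    have n3 : ‖A + B + -C + L‖ ≤ ‖A‖ + ‖B‖ + ‖C‖ + ‖L‖ := by
      calc ‖A + B + -C + L‖ ≤ ‖A + B + -C‖ + ‖L‖ := norm_add_le _ _
        _ ≤ ‖A + B‖ + ‖-C‖ + ‖L‖ := by gcongr; exact norm_add_le _ _
        _ ≤ ‖A‖ + ‖B‖ + ‖C‖ + ‖L‖ := by rw [norm_neg]; gcongr; exact norm_add_le _ _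
    refine n3.trans ?_
    refine (add_le_add (add_le_add (add_le_add hSm hM) hSn) hLg).trans ?_
    have h1 : KS * ((n : ℝ) ^ 2)⁻¹ * (ρ ^ (d + 1))⁻¹ * Real.exp (-(ρ / 2)) ≤ KS * X * Real.exp (-(ρ / 64)) := by
      rw [hX, ← mul_assoc]; exact mul_le_mul_of_nonneg_left e2 (by positivity)
    have h2 : KM * ((n : ℝ) ^ 2)⁻¹ * (ρ ^ (d + 1))⁻¹ * Real.exp (-(ρ / 16)) ≤ KM * X * Real.exp (-(ρ / 64)) := by
      rw [hX, ← mul_assoc]; exact mul_le_mul_of_nonneg_left e16 (by positivity)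
    have h3 : KL * ((n : ℝ) ^ 2)⁻¹ * (ρ ^ (d + 1))⁻¹ * Real.exp (-(ρ / 64)) = KL * X * Real.exp (-(ρ / 64)) := by
      rw [hX, ← mul_assoc]
    calc KS * ((n : ℝ) ^ 2)⁻¹ * (ρ ^ (d + 1))⁻¹ * Real.exp (-(ρ / 2)) +
          KM * ((n : ℝ) ^ 2)⁻¹ * (ρ ^ (d + 1))⁻¹ * Real.exp (-(ρ / 16)) +
          KS * ((n : ℝ) ^ 2)⁻¹ * (ρ ^ (d + 1))⁻¹ * Real.exp (-(ρ / 2)) +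
          KL * ((n : ℝ) ^ 2)⁻¹ * (ρ ^ (d + 1))⁻¹ * Real.exp (-(ρ / 64))
        ≤ KS * X * Real.exp (-(ρ / 64)) + KM * X * Real.exp (-(ρ / 64)) + KS * X * Real.exp (-(ρ / 64)) +
          KL * X * Real.exp (-(ρ / 64)) := by rw [h3]; exact add_le_add (add_le_add (add_le_add h1 h2) h1) le_rfl
      _ = _ := by ring
  -- the `rpow` shape of the target
  have r1 : (n : ℝ) ^ (-(2 : ℝ)) = ((n : ℝ) ^ 2)⁻¹ := by
    rw [Real.rpow_neg hn0.le, show (2 : ℝ) = ((2 : ℕ) : ℝ) by norm_num, Real.rpow_natCast]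
  have r2 : ρ ^ (1 - (d : ℝ) - 2) = (ρ ^ (d + 1))⁻¹ := by
    rw [show (1 - (d : ℝ) - 2) = -((d + 1 : ℕ) : ℝ) by push_cast; ring, Real.rpow_neg hρ.le, Real.rpow_natCast]
  have r3 : Real.exp (-(1 / 64 * ρ)) = Real.exp (-(ρ / 64)) := by congr 1; ring
  rw [r1, r2, r3]
  calc _ ≤ (KS + KM + KS + KL) * X * Real.exp (-(ρ / 64)) := hT
    _ = _ := by rw [hX]; ring

/-- **`FreePartRate d N` holds** for every `d` and `N` (with `γ = 2`, `δ = 1/64`): the free part of Bałaban's (1.83)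
covariance kernel converges at rate `n^{−2}` in the fine-lattice level, pointwise off the origin, with the integrable
singular weight `ρ^{−(d+1)}` and exponential tail `e^{−ρ/64}` in the physical sup-distance `ρ`. This discharges the
typed wall of `G183KernelRates` (there recorded as the MISSING inequality of gen 7). [folklore] -/
theorem freePartRate (d N : ℕ) : G183KernelRates.FreePartRate d N := by
  obtain ⟨C, hC⟩ := freePartRateShape_two d N
  exact ⟨2, C, 1 / 64, by norm_num, by norm_num, hC⟩

/-- The shape with a NONNEGATIVE constant (the right-hand side is monotone in `C`). [folklore] -/
theorem freePartRateShape_two_nonneg (d N : ℕ) :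
    ∃ C : ℝ, 0 ≤ C ∧ G183KernelRates.FreePartRateShape d N 2 C (1 / 64) := by
  obtain ⟨C, hC⟩ := freePartRateShape_two d N
  refine ⟨max C 0, le_max_right C 0, ?_⟩
  intro n m _ _ hnm x x' hx hx'
  refine (hC n m hnm x x' hx hx').trans ?_
  have h1 : (0 : ℝ) ≤ (n : ℝ) ^ (-(2 : ℝ)) := Real.rpow_nonneg (Nat.cast_nonneg n) _
  have h2 : (0 : ℝ) ≤ (B4ContourShift.supNorm x / n) ^ (1 - (d : ℝ) - 2) :=
    Real.rpow_nonneg (div_nonneg (B4ContourShift.supNorm_nonneg x) (Nat.cast_nonneg n)) _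
  have h3 := Real.exp_nonneg (-(1 / 64 * (B4ContourShift.supNorm x / n)))
  exact mul_le_mul_of_nonneg_right (mul_le_mul_of_nonneg_right
    (mul_le_mul_of_nonneg_right (le_max_left C 0) h1) h2) h3

/-- **UNCONDITIONAL COARSE-POINT COROLLARY** — gen 7's bookkeeping implication `G183KernelRates.freePartRateShape_offDiag`
with its antecedent now discharged: on the `L`-adic family of levels `n = L^k`, at every coarse point `y ≠ 0` (`d ≥ 1`),
`|K^free_{L^{k+1}}(L^{k+1}•y) − K^free_{L^k}(L^k•y)| ≤ C · (L^{−2})^k · e^{−|y|_∞/64}` — summable in the scale `k` at the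
geometric rate `L^{−2k}` (King's `L^{−γk}` with `γ = 2`), uniformly off the origin; at `y = 0` no such bound exists
(`G183KernelRates.freeKerFamily_zero_unbounded`). [folklore] -/
theorem freeKerFamily_succ_sub_le {d : ℕ} (hd : 1 ≤ d) (N L : ℕ) [NeZero L] :
    ∃ C : ℝ, 0 ≤ C ∧ ∀ (k : ℕ) (y : Fin (d + 1) → ℤ), y ≠ 0 →
      |G183KernelRates.freeKerFamily (d := d) L N (k + 1) y - G183KernelRates.freeKerFamily (d := d) L N k y| ≤
        C * (((L : ℝ) ^ (-(2 : ℝ))) ^ k) * Real.exp (-(1 / 64 * B4ContourShift.supNorm y)) := by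
  obtain ⟨C, hC0, hC⟩ := freePartRateShape_two_nonneg d N
  exact ⟨C, hC0, fun k y hy => G183KernelRates.freePartRateShape_offDiag hd (by norm_num) hC0 hC L k y hy⟩

end Main

end Summit.QuantumFields.BalabanUV.T4Continuum.G183FreePartRate
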